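import Summits.Ventures.YMGap.RobustBall.TranslateAverageDLR
import Summits.Ventures.YMGap.RobustBall.ErgodicAverages
import Summits.Ventures.YMGap.RobustBall.SpecificHeatFloor
import Summits.Ventures.YMGap.RobustBall.OneStateInvariant
import Summits.Ventures.YMGap.Thresholds.CouplingDerivativeDim
import HarnessLib

/-!
# Venture YMGap, track ROBUST-BALL — «C-EST»: ESTIMATING THE COUPLING FROM A FINITE WINDOW OF ONE SAMPLE, with explicit non-asymptotic
# confidence (`SU(2)` on `ℤ⁴`, tree couplings `b ∈ [0, 9/50)`)

HONEST FRAMING. WHAT THIS IS: a venture file (cell `pub-ymgap`, track Y2 ROBUST-BALL / DS, seat ds-3, theorems only, 0 compute, 0 defs): the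
FINITE-WINDOW, QUANTITATIVE form of «C-SING sharp form» (`CouplingIdentification`: one measurable `T` with `T = b` almost surely under the
state at `b`, every `b` of the window). Write `W(U) = ½ Re tr U_{p₀}` for the plaquette `p₀ = (0; 0, 1)` and `A_B(U) = #B⁻¹ Σ_{x∈B} W(θ_x U)`
for the empirical mean plaquette over a finite nonempty set `B ⊂ ℤ⁴` of translates — a function of the finitely many links of the plaquettes
`θ_x p₀`, `x ∈ B`, of ONE infinite-volume sample `U`. There is ONE monotone read-out `g : ℝ → [0, 9/50]` (the generalised inverse of the mean-
plaquette curve `b ↦ u(b) = ⟨W⟩_b`) such that the local estimator `T_B = g ∘ A_B` satisfies, for EVERY DLR state `μ ∈ 𝒢(b)`: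

* `mul_abs_genInv_sub_le` (generic) — for a curve with lower modulus `c (t − s) ≤ u t − u s` on `[0, L)`, the generalised inverse obeys
  `c · |g(y) − b| ≤ |y − u(b)|` for EVERY real `y` and every `b ∈ [0, L)` (deterministic error transfer);
* `su2_plaquette_increment_ge_uniform` — the uniform lower modulus of the mean plaquette on the window: `e^{−216/25}/24 · (t − s) ≤ u(t) − u(s)`
  for `0 ≤ s < t < 9/50` (from `EnergyVariance.su2_plaquette_increment_ge`, strong convexity of the free energy; the endpoint `s = 0` by
  monotonicity `PressureRegularity.su2_plaquette_monotoneOn` and a limiting argument);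
* ★★ `su2_coupling_readout` — ONE monotone `g : ℝ → [0, 9/50]` with `e^{−216/25}/24 · |g(y) − b| ≤ |y − ⟨W⟩_μ|` for every `b ∈ [0, 9/50)`, every
  `μ ∈ 𝒢(b)` and every real `y`: ANY estimate of the mean plaquette is an estimate of the coupling, error amplified by at most `24 e^{216/25}`;
* ★★★ `su2_couplingEstimator_tail_exp` — `b ∈ [0, 1/9)` (Wilson `β_W < 2/9`), HYPOTHESIS-FREE, every finite nonempty `B`, every `ε ≥ 0`:
  `μ{|T_B − b| ≥ ε} ≤ 2e^{2/3} exp(−(e^{−216/25}/24) ε √((1 − 9b) #B / 64))` (heat-bath Poincaré route, `HeatBathConcentration.su2_gibbs_translateAverage_deviation_le`);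
* ★★★ `su2_coupling_estimator_exp` — ONE measurable monotone read-out `g : ℝ → [0, 9/50]` whose local estimator `T_B = g ∘ A_B` has the exponential
  confidence above under every DLR state at every `b ∈ [0, 1/9)`: the coupling of strong-coupling `SU(2)` lattice Yang–Mills is CONSISTENTLY ESTIMABLE
  from a finite window of a single sample, with an explicit non-asymptotic rate. The companion file `CouplingEstimationWindow` gives, for the same
  read-outs, Gaussian confidence on `b ∈ [0, 1/24]` and Chebyshev confidence `C_b/(ε² #B)` on the WHOLE window `b ∈ [0, 9/50)`.

WHAT THIS IS NOT: the window is a finite set of plaquettes of an INFINITE-volume sample (DLR state), not a finite-volume Gibbs kernel with boundary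
condition; the constant `24 e^{216/25}` is a door artefact of the strong-convexity floor, not an optimal Fisher-information rate; lattice strong
coupling only; nothing about the continuum limit or Clay. Everything here is proved. [folklore]

References (context — consistency of coupling estimators for Gibbs random fields from one sample, Ising-type models): F. Comets, Ann. Statist. 20
(1992) 455–468; S. Chatterjee, Ann. Statist. 35 (2007) 1931–1946; B. B. Bhattacharya, S. Mukherjee, Bernoulli 24 (2018) 493–525 (arXiv:1507.07055).
The present file is the strong-coupling lattice-gauge case with a moment (mean-plaquette) read-out and explicit non-asymptotic confidence.
-/

noncomputable section

open MeasureTheory ProbabilityTheory Filter Topology Real Finset Set Function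
open scoped NNReal ENNReal
open Literature.Probability.LatticeModels hiding configShift configShift_apply
open Literature.MathematicalPhysics.QuantumLattice
open Literature.MathematicalPhysics.QuantumFieldTheory hiding ZdEdge Site IsLocalObservable

namespace Summit.Ventures.YMGap.RobustBall

namespace CouplingEstimation

/-! ### Generic: the generalised inverse of a curve with a lower modulus of increase -/

section Generic

variable {u : ℝ → ℝ} {L c : ℝ}

/-- The generalised inverse `y ↦ sup {t ∈ [0, L) : u t ≤ y}` takes values in `[0, L]` (`L ≥ 0`; the empty supremum is `0`). [folklore] -/
theorem genInv_mem_Icc (hL : 0 ≤ L) (y : ℝ) : sSup {t ∈ Ico (0 : ℝ) L | u t ≤ y} ∈ Icc (0 : ℝ) L := by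
  by_cases hne : ({t ∈ Ico (0 : ℝ) L | u t ≤ y} : Set ℝ).Nonempty
  · have hbdd : BddAbove {t ∈ Ico (0 : ℝ) L | u t ≤ y} := ⟨L, fun t ht => ht.1.2.le⟩
    obtain ⟨t₀, ht₀⟩ := hne
    exact ⟨ht₀.1.1.trans (le_csSup hbdd ht₀), csSup_le ⟨t₀, ht₀⟩ fun t ht => ht.1.2.le⟩
  · rw [Set.not_nonempty_iff_eq_empty.1 hne, Real.sSup_empty]
    exact ⟨le_rfl, hL⟩

/-- The generalised inverse is monotone (hence measurable). [folklore] -/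
theorem monotone_genInv (u : ℝ → ℝ) (L : ℝ) : Monotone fun y : ℝ => sSup {t ∈ Ico (0 : ℝ) L | u t ≤ y} := by
  intro y y' hyy
  show sSup {t ∈ Ico (0 : ℝ) L | u t ≤ y} ≤ sSup {t ∈ Ico (0 : ℝ) L | u t ≤ y'}
  have hsub : {t ∈ Ico (0 : ℝ) L | u t ≤ y} ⊆ {t ∈ Ico (0 : ℝ) L | u t ≤ y'} := fun t ht => ⟨ht.1, ht.2.trans hyy⟩
  have hbdd : BddAbove {t ∈ Ico (0 : ℝ) L | u t ≤ y'} := ⟨L, fun t ht => ht.1.2.le⟩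
  by_cases hne : ({t ∈ Ico (0 : ℝ) L | u t ≤ y} : Set ℝ).Nonempty
  · exact csSup_le_csSup hbdd hne hsub
  · rw [Set.not_nonempty_iff_eq_empty.1 hne, Real.sSup_empty]
    by_cases hne' : ({t ∈ Ico (0 : ℝ) L | u t ≤ y'} : Set ℝ).Nonempty
    · obtain ⟨t, ht⟩ := hne'
      exact ht.1.1.trans (le_csSup hbdd ht)
    · rw [Set.not_nonempty_iff_eq_empty.1 hne', Real.sSup_empty]

/-- **DETERMINISTIC ERROR TRANSFER.** If `c (t − s) ≤ u t − u s` for all `s < t` in `[0, L)` (`c > 0`), then for every `b ∈ [0, L)` and EVERY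
real `y`, the generalised inverse `g(y) = sup {t ∈ [0, L) : u t ≤ y}` satisfies `c · |g(y) − b| ≤ |y − u(b)|`. [folklore] -/
theorem mul_abs_genInv_sub_le (hc : 0 < c)
    (hmod : ∀ s ∈ Ico (0 : ℝ) L, ∀ t ∈ Ico (0 : ℝ) L, s < t → c * (t - s) ≤ u t - u s) {b : ℝ} (hb : b ∈ Ico (0 : ℝ) L)
    (y : ℝ) : c * |sSup {t ∈ Ico (0 : ℝ) L | u t ≤ y} - b| ≤ |y - u b| := by
  set A : Set ℝ := {t ∈ Ico (0 : ℝ) L | u t ≤ y} with hA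
  have hbdd : BddAbove A := ⟨L, fun t ht => ht.1.2.le⟩
  rcases le_or_gt (u b) y with hy | hy
  · -- `b ∈ A`, and every element of `A` is at most `b + (y - u b)/c`
    have hbA : b ∈ A := ⟨hb, hy⟩
    have hbg : b ≤ sSup A := le_csSup hbdd hbA
    have hub : ∀ t ∈ A, t ≤ b + (y - u b) / c := by
      intro t ht
      rcases le_or_gt t b with htb | htb
      · exact htb.trans (le_add_of_nonneg_right (div_nonneg (sub_nonneg.2 hy) hc.le))
      · have h1 := hmod b hb t ht.1 htb
        have h2 : (t - b) * c ≤ y - u b := by rw [mul_comm]; linarith [ht.2]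
        have h3 : t - b ≤ (y - u b) / c := (le_div_iff₀ hc).2 h2
        linarith
    have hg : sSup A ≤ b + (y - u b) / c := csSup_le ⟨b, hbA⟩ hub
    rw [abs_of_nonneg (sub_nonneg.2 hbg), abs_of_nonneg (sub_nonneg.2 hy)]
    calc c * (sSup A - b) ≤ c * ((y - u b) / c) := mul_le_mul_of_nonneg_left (by linarith) hc.le
      _ = y - u b := mul_div_cancel₀ _ hc.ne'
  · -- every element of `A` is `< b`
    have hlt : ∀ t ∈ A, t < b := by
      intro t ht
      by_contra h
      rcases (not_lt.1 h).eq_or_lt with heq | hbt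
      · rw [heq] at hy
        linarith [ht.2]
      · have h1 := hmod b hb t ht.1 hbt
        have h2 : 0 < c * (t - b) := mul_pos hc (by linarith)
        linarith [ht.2]
    have hg0 : 0 ≤ sSup A := (genInv_mem_Icc (u := u) (hb.1.trans hb.2.le) y).1
    have hgb : sSup A ≤ b := by
      by_cases hne : A.Nonempty
      · exact csSup_le hne fun t ht => (hlt t ht).le
      · rw [Set.not_nonempty_iff_eq_empty.1 hne, Real.sSup_empty]
        exact hb.1
    rw [abs_of_nonpos (sub_nonpos.2 hgb), abs_of_neg (sub_neg.2 hy), neg_sub, neg_sub]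
    by_cases hs : c * b ≤ u b - y
    · calc c * (b - sSup A) ≤ c * b := mul_le_mul_of_nonneg_left (by linarith) hc.le
        _ ≤ u b - y := hs
    · have hs' : u b - y < c * b := not_le.1 hs
      set s : ℝ := b - (u b - y) / c with hs_def
      have e : c * (b - s) = u b - y := by
        rw [hs_def]
        field_simp
        ring
      have hq : 0 < (u b - y) / c := div_pos (by linarith) hc
      have hq' : (u b - y) / c < b := (div_lt_iff₀ hc).2 (by linarith)
      have hs0 : 0 ≤ s := by rw [hs_def]; linarith
      have hsb : s < b := by rw [hs_def]; linarith
      have hsI : s ∈ Ico (0 : ℝ) L := ⟨hs0, hsb.trans hb.2⟩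
      have hus : u s ≤ y := by
        have h1 := hmod s hsI b hb hsb
        linarith
      have hsg : s ≤ sSup A := le_csSup hbdd ⟨hsI, hus⟩
      calc c * (b - sSup A) ≤ c * (b - s) := mul_le_mul_of_nonneg_left (by linarith) hc.le
        _ = u b - y := e

end Generic

/-! ### `SU(2)`, `d = 4`: the uniform lower modulus of the mean plaquette and the read-out -/

section SU2

/-- **UNIFORM LOWER MODULUS OF THE MEAN PLAQUETTE ON THE WINDOW** (`SU(2)`, `d = 4`, tree couplings): for `0 ≤ s < t < 9/50` and any DLR
states `ν_s ∈ 𝒢(s)`, `ν_t ∈ 𝒢(t)`, `e^{−216/25}/24 · (t − s) ≤ ⟨W⟩_{ν_t} − ⟨W⟩_{ν_s}` (`W = ½ Re tr U_{p₀}`; `216/25 = 48 · 9/50`). [folklore] -/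
theorem su2_plaquette_increment_ge_uniform {s t : ℝ} (hs : 0 ≤ s) (hst : s < t) (ht : t < 9 / 50)
    {νs νt : Measure (LGConfig 4 (SUN 2))}
    (hνs : νs ∈ ymGibbsMeasures (d := 4) (fundamentalRep (Fin 2)) s)
    (hνt : νt ∈ ymGibbsMeasures (d := 4) (fundamentalRep (Fin 2)) t) :
    Real.exp (-(216 / 25)) / 24 * (t - s) ≤
      (∫ U, zdPlaquetteObs (fundamentalRep (Fin 2)) 0 0 1 U ∂νt) - ∫ U, zdPlaquetteObs (fundamentalRep (Fin 2)) 0 0 1 U ∂νs := by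
  have hexp : Real.exp (-(216 / 25)) ≤ Real.exp (-(48 * t)) := Real.exp_le_exp.2 (by linarith)
  -- the interior case, for any pair of states
  have interior : ∀ {m : ℝ} {νm : Measure (LGConfig 4 (SUN 2))}, 0 < m → m < t →
      νm ∈ ymGibbsMeasures (d := 4) (fundamentalRep (Fin 2)) m →
      Real.exp (-(216 / 25)) / 24 * (t - m) ≤
        (∫ U, zdPlaquetteObs (fundamentalRep (Fin 2)) 0 0 1 U ∂νt) - ∫ U, zdPlaquetteObs (fundamentalRep (Fin 2)) 0 0 1 U ∂νm := by
    intro m νm hm0 hmt hνm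
    have h := EnergyVariance.su2_plaquette_increment_ge hm0 hmt ht hνm hνt
    have : Real.exp (-(216 / 25)) / 24 * (t - m) ≤ Real.exp (-(48 * t)) / 24 * (t - m) :=
      mul_le_mul_of_nonneg_right (div_le_div_of_nonneg_right hexp (by norm_num)) (by linarith)
    linarith
  rcases hs.eq_or_lt with h0 | hs0
  · -- `s = 0`: monotonicity from `0` to `m`, the modulus from `m` to `t`, and `m → 0`
    subst h0
    obtain ⟨ν, hν⟩ := CouplingResponse.exists_dlrSelection_dim (d := 4) (N := 2)
    have ht0 : 0 < t := hst
    -- monotonicity `⟨W⟩_{νs} ≤ ⟨W⟩_{ν m}` for `0 ≤ m ≤ 9/50`, along the selection through `νs` at `0`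
    have hmono : ∀ m : ℝ, 0 < m → m ≤ 9 / 50 →
        ∫ U, zdPlaquetteObs (fundamentalRep (Fin 2)) 0 0 1 U ∂νs ≤ ∫ U, zdPlaquetteObs (fundamentalRep (Fin 2)) 0 0 1 U ∂(ν m) := by
      intro m hm0 hm
      classical
      set μ' : ℝ → Measure (LGConfig 4 (SUN 2)) := fun β => if β = 0 then νs else ν β with hμ'
      have hsel : ∀ β ∈ Icc (0 : ℝ) (9 / 50), μ' β ∈ ymGibbsMeasures (d := 4) (fundamentalRep (Fin 2)) β := by
        intro β _
        by_cases hβ : β = 0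
        · simp only [hμ', hβ, if_true]; exact hνs
        · simp only [hμ', hβ, if_false]; exact hν β
      have hM := PressureRegularity.su2_plaquette_monotoneOn (μ := μ') hsel
        (((0 : Literature.Probability.LatticeModels.Site 4), ⟨((0 : Fin 4), (1 : Fin 4)), by decide⟩) : ZdPlaquette 4)
        (show (0 : ℝ) ∈ Icc (0 : ℝ) (9 / 50) from ⟨le_rfl, by norm_num⟩) (show m ∈ Icc (0 : ℝ) (9 / 50) from ⟨hm0.le, hm⟩) hm0.le
      have e0 := PressureRegularity.integral_plaquetteObs_eq_mul
        (((0 : Literature.Probability.LatticeModels.Site 4), ⟨((0 : Fin 4), (1 : Fin 4)), by decide⟩) : ZdPlaquette 4) (μ' 0)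
      have em := PressureRegularity.integral_plaquetteObs_eq_mul
        (((0 : Literature.Probability.LatticeModels.Site 4), ⟨((0 : Fin 4), (1 : Fin 4)), by decide⟩) : ZdPlaquette 4) (μ' m)
      have h0' : μ' 0 = νs := by simp [hμ']
      have hm' : μ' m = ν m := by simp [hμ', hm0.ne']
      simp only at hM e0 em
      rw [e0, em, h0', hm'] at hM
      push_cast at hM
      linarith
    refine le_of_forall_pos_le_add fun δ hδ => ?_
    set m : ℝ := min (t / 2) (δ / (Real.exp (-(216 / 25)) / 24)) with hm
    have hc0 : 0 < Real.exp (-(216 / 25)) / 24 := by positivity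
    have hm0 : 0 < m := lt_min (by linarith) (div_pos hδ hc0)
    have hmt : m < t := (min_le_left _ _).trans_lt (by linarith)
    have hmδ : Real.exp (-(216 / 25)) / 24 * m ≤ δ := by
      have : m ≤ δ / (Real.exp (-(216 / 25)) / 24) := min_le_right _ _
      rwa [le_div_iff₀ hc0, mul_comm] at this
    have h1 := interior hm0 hmt (hν m)
    have h2 := hmono m hm0 (by linarith)
    rw [sub_zero]
    nlinarith
  · exact interior hs0 hst hνs

/-- ★★ **THE READ-OUT** (`SU(2)`, `d = 4`): there is ONE monotone `g : ℝ → [0, 9/50]` such that for every tree coupling `b ∈ [0, 9/50)`, every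
DLR state `μ ∈ 𝒢(b)` and EVERY real number `y`, `e^{−216/25}/24 · |g(y) − b| ≤ |y − ⟨W⟩_μ|` (`W = ½ Re tr U_{p₀}`): any estimate `y` of the
mean plaquette is turned into an estimate `g(y)` of the coupling, the error amplified by at most `24 e^{216/25}`. [folklore] -/
theorem su2_coupling_readout :
    ∃ g : ℝ → ℝ, Monotone g ∧ (∀ y, g y ∈ Icc (0 : ℝ) (9 / 50)) ∧
      ∀ b : ℝ, 0 ≤ b → b < 9 / 50 → ∀ μ : Measure (LGConfig 4 (SUN 2)), μ ∈ ymGibbsMeasures (d := 4) (fundamentalRep (Fin 2)) b →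
        ∀ y : ℝ, Real.exp (-(216 / 25)) / 24 * |g y - b| ≤ |y - ∫ U, zdPlaquetteObs (fundamentalRep (Fin 2)) 0 0 1 U ∂μ| := by
  obtain ⟨ν, hν⟩ := CouplingResponse.exists_dlrSelection_dim (d := 4) (N := 2)
  set u : ℝ → ℝ := fun t => ∫ U, zdPlaquetteObs (fundamentalRep (Fin 2)) 0 0 1 U ∂(ν t) with hu
  refine ⟨fun y => sSup {t ∈ Ico (0 : ℝ) (9 / 50) | u t ≤ y}, monotone_genInv u _, fun y => genInv_mem_Icc (by norm_num) y,
    fun b hb0 hb μ hμ y => ?_⟩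
  -- uniqueness of the DLR state on the window: `μ = ν b`
  obtain ⟨μ', h1, -⟩ := su2_wilson_oneState_translationInvariant (b := b) (abs_le.2 ⟨by linarith, by linarith⟩)
  have hμμ : μ = μ' := by rw [h1] at hμ; exact Set.mem_singleton_iff.1 hμ
  have hνμ : ν b = μ := by
    have h := hν b
    rw [h1] at h
    rw [hμμ]
    exact Set.mem_singleton_iff.1 h
  have e : ∫ U, zdPlaquetteObs (fundamentalRep (Fin 2)) 0 0 1 U ∂μ = u b := by simp only [hu]; rw [hνμ]
  rw [e]
  exact mul_abs_genInv_sub_le (u := u) (L := 9 / 50) (by positivity)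
    (fun s hs t ht hst => su2_plaquette_increment_ge_uniform hs.1 hst ht.2 (hν s) (hν t)) ⟨hb0, hb⟩ y

/-! ### Confidence bounds for the local estimator `T_B = g(A_B)` -/

/-- The mean of the empirical mean plaquette under the (translation-invariant) state is `⟨W⟩_μ`. [folklore] -/
theorem su2_integral_boxAverage_plaquette {b : ℝ} (hb : |b| ≤ 9 / 50) {μ : Measure (LGConfig 4 (SUN 2))}
    (hμ : μ ∈ ymGibbsMeasures (d := 4) (fundamentalRep (Fin 2)) b) (B : Finset (Literature.Probability.LatticeModels.Site 4)) :
    ∫ U, ∑ x ∈ B, zdPlaquetteObs (fundamentalRep (Fin 2)) 0 0 1 (configShift x U) ∂μ =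
      B.card * ∫ U, zdPlaquetteObs (fundamentalRep (Fin 2)) 0 0 1 U ∂μ := by
  obtain ⟨μ', h1, hinv⟩ := su2_wilson_oneState_translationInvariant hb
  have hμμ : μ = μ' := by rw [h1] at hμ; exact Set.mem_singleton_iff.1 hμ
  have hG : IsGibbsMeasure (ymSpecification (d := 4) (fundamentalRep (Fin 2)) b) μ := hμ
  haveI := hG.isProbabilityMeasure
  rw [← hμμ] at hinv
  have hρc : Continuous (fundamentalRep (Fin 2)) := continuous_fundamentalRep (Fin 2)
  have hFm : Measurable (zdPlaquetteObs (d := 4) (fundamentalRep (Fin 2)) 0 0 1) :=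
    (isLipschitzCylinder_zdPlaquetteObs (N := 2) (d := 4) 0 (show (0 : Fin 4) < 1 by decide)).measurable
  have hFb : ∀ U, |zdPlaquetteObs (d := 4) (fundamentalRep (Fin 2)) 0 0 1 U| ≤ 1 := fun U =>
    abs_zdPlaquetteObs_le (fun g => fundamentalRep_mem_unitaryGroup g) 0 0 1 U
  rw [integral_finsetSum _ fun x _ => ?_]
  · simp_rw [ErgodicAverages.integral_comp_shift hinv _]
    rw [Finset.sum_const, nsmul_eq_mul]
  · exact Literature.Probability.LatticeModels.DobrushinMetric.integrable_of_abs_le' (hFm.comp (configShift x).measurable) fun U => hFb _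

/-- ★★★ **EXPONENTIAL CONFIDENCE, HYPOTHESIS-FREE** (`SU(2)`, `d = 4`, tree couplings `b ∈ [0, 1/9)`, i.e. Wilson `β_W < 2/9`): for any read-out
`g` as in `su2_coupling_readout`, every DLR state `μ ∈ 𝒢(b)`, every finite nonempty `B ⊂ ℤ⁴` and every `ε ≥ 0`,
`μ{ε ≤ |g(A_B) − b|} ≤ 2e^{2/3} exp(−(e^{−216/25}/24) ε √((1 − 9b) #B / 64))`. [folklore] -/
theorem su2_couplingEstimator_tail_exp {g : ℝ → ℝ}
    (hg : ∀ b : ℝ, 0 ≤ b → b < 9 / 50 → ∀ μ : Measure (LGConfig 4 (SUN 2)), μ ∈ ymGibbsMeasures (d := 4) (fundamentalRep (Fin 2)) b →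
      ∀ y : ℝ, Real.exp (-(216 / 25)) / 24 * |g y - b| ≤ |y - ∫ U, zdPlaquetteObs (fundamentalRep (Fin 2)) 0 0 1 U ∂μ|)
    {b : ℝ} (hb0 : 0 ≤ b) (hb : b < 1 / 9) {μ : Measure (LGConfig 4 (SUN 2))}
    (hμ : μ ∈ ymGibbsMeasures (d := 4) (fundamentalRep (Fin 2)) b) {B : Finset (Literature.Probability.LatticeModels.Site 4)}
    (hB : B.Nonempty) {ε : ℝ} (hε : 0 ≤ ε) :
    μ.real {U | ε ≤ |g ((∑ x ∈ B, zdPlaquetteObs (fundamentalRep (Fin 2)) 0 0 1 (configShift x U)) / B.card) - b|} ≤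
      2 * (Real.exp (2 / 3) * Real.exp (-(Real.exp (-(216 / 25)) / 24 * ε * Real.sqrt ((1 - 9 * b) * B.card / 64)))) := by
  classical
  have hG : IsGibbsMeasure (ymSpecification (d := 4) (fundamentalRep (Fin 2)) b) μ := hμ
  haveI := hG.isProbabilityMeasure
  set F : LGConfig 4 (SUN 2) → ℝ := zdPlaquetteObs (fundamentalRep (Fin 2)) 0 0 1 with hF
  set p₀ : ZdPlaquette 4 := ((0 : Literature.Probability.LatticeModels.Site 4), ⟨((0 : Fin 4), (1 : Fin 4)), by decide⟩) with hp₀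
  set Δ : Finset (ZdEdge 4) := plaquetteEdges p₀ with hΔ
  have hLip : IsLipschitzCylinder (fundamentalRep (Fin 2)) F Δ (4 * (2 : ℝ≥0) ^ 3) :=
    isLipschitzCylinder_zdPlaquetteObs (N := 2) (d := 4) 0 (show (0 : Fin 4) < 1 by decide)
  have hFb : ∀ U, |F U| ≤ 1 := fun U => abs_zdPlaquetteObs_le (fun g => fundamentalRep_mem_unitaryGroup g) 0 0 1 U
  -- link oscillations `δ = 2` on the four links of `p₀`, `0` elsewhere
  set δ : ZdEdge 4 → ℝ := fun e => if e ∈ Δ then 2 else 0 with hδ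
  have hδ0 : ∀ e, 0 ≤ δ e := fun e => by simp only [hδ]; split_ifs <;> norm_num
  have hδΔ : ∀ e, e ∉ Δ → δ e = 0 := fun e he => by simp only [hδ, he, if_false]
  have hosc : ∀ e U s, |F U - F (update U e s)| ≤ δ e := by
    intro e U s
    by_cases he : e ∈ Δ
    · simp only [hδ, he, if_true]
      calc |F U - F (update U e s)| ≤ |F U| + |F (update U e s)| := abs_sub _ _
        _ ≤ 1 + 1 := add_le_add (hFb _) (hFb _)
        _ = 2 := by norm_num
    · simp only [hδ, he, if_false]
      have hcyl := hLip.isCylinder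
      have : F (update U e s) = F U := hcyl fun i hi => by
        have hie : i ≠ e := fun h => he (h ▸ (Finset.mem_coe.1 hi))
        exact update_of_ne hie _ _
      rw [this, sub_self, abs_zero]
  have hcard : Δ.card ≤ 4 := card_plaquetteEdges_le p₀
  have hmem : ((0 : Literature.Probability.LatticeModels.Site 4), (0 : Fin 4)) ∈ Δ := by simp [hΔ, hp₀, plaquetteEdges]
  have hcard1 : 1 ≤ Δ.card := Finset.card_pos.2 ⟨_, hmem⟩
  have hsum : ∑ e ∈ Δ, δ e = 2 * Δ.card := by
    rw [Finset.sum_congr rfl fun e (he : e ∈ Δ) => show δ e = 2 by simp only [hδ, he, if_true], Finset.sum_const, nsmul_eq_mul, mul_comm]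
  have hL : 0 < ∑ e ∈ Δ, δ e := by
    rw [hsum]
    have h1 : (1 : ℝ) ≤ Δ.card := by exact_mod_cast hcard1
    linarith
  have hβ : (2 * b) / 2 = b := by ring
  have hμ' : μ ∈ ymGibbsMeasures (d := 4) (fundamentalRep (Fin 2)) ((2 * b) / 2) := by rw [hβ]; exact hμ
  have key := HeatBathConcentration.su2_gibbs_translateAverage_deviation_le (βW := 2 * b) (by linarith) (by linarith) hμ' hLip hδ0 hδΔ hosc hL hB
    (r := Real.exp (-(216 / 25)) / 24 * ε) (by positivity)
  -- the centre of the translate average is `⟨W⟩_μ`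
  have hBpos : (0 : ℝ) < B.card := by exact_mod_cast hB.card_pos
  have hcentre : ∫ U', (B.card : ℝ)⁻¹ * ∑ x ∈ B, F (configShift x U') ∂μ = ∫ U, F U ∂μ := by
    rw [integral_const_mul, su2_integral_boxAverage_plaquette (b := b) (abs_le.2 ⟨by linarith, by linarith⟩) hμ B,
      ← mul_assoc, inv_mul_cancel₀ hBpos.ne', one_mul]
  rw [hcentre] at key
  -- event inclusion through the read-out inequality
  have hsub : {U | ε ≤ |g ((∑ x ∈ B, F (configShift x U)) / B.card) - b|} ⊆
      {U | Real.exp (-(216 / 25)) / 24 * ε ≤ |(B.card : ℝ)⁻¹ * ∑ x ∈ B, F (configShift x U) - ∫ U, F U ∂μ|} := by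
    intro U hU
    have h1 := hg b hb0 (by linarith) μ hμ ((∑ x ∈ B, F (configShift x U)) / B.card)
    have h2 : Real.exp (-(216 / 25)) / 24 * ε ≤ Real.exp (-(216 / 25)) / 24 * |g ((∑ x ∈ B, F (configShift x U)) / B.card) - b| :=
      mul_le_mul_of_nonneg_left hU (by positivity)
    show Real.exp (-(216 / 25)) / 24 * ε ≤ |(B.card : ℝ)⁻¹ * ∑ x ∈ B, F (configShift x U) - ∫ U, F U ∂μ|
    rw [inv_mul_eq_div]
    exact h2.trans h1
  refine (measureReal_mono hsub).trans (key.trans ?_)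
  -- constants: `(Σ δ)² ≤ 64`, `1 − 9(2b)/2 = 1 − 9b`
  have hS64 : (∑ e ∈ Δ, δ e) ^ 2 ≤ 64 := by
    rw [hsum]
    have : (Δ.card : ℝ) ≤ 4 := by exact_mod_cast hcard
    nlinarith
  have hSpos : 0 < (∑ e ∈ Δ, δ e) ^ 2 := by positivity
  have h9 : 1 - 9 * (2 * b) / 2 = 1 - 9 * b := by ring
  rw [h9]
  have hnum : 0 ≤ (1 - 9 * b) * B.card := mul_nonneg (by linarith) hBpos.le
  have hsq : Real.sqrt ((1 - 9 * b) * B.card / 64) ≤ Real.sqrt ((1 - 9 * b) * B.card / (∑ e ∈ Δ, δ e) ^ 2) :=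
    Real.sqrt_le_sqrt (div_le_div_of_nonneg_left hnum hSpos hS64)
  have hr0 : 0 ≤ Real.exp (-(216 / 25)) / 24 * ε := by positivity
  gcongr
/-- ★★★ **THE COUPLING OF STRONG-COUPLING `SU(2)` LATTICE YANG–MILLS IS CONSISTENTLY ESTIMABLE FROM A FINITE WINDOW OF ONE SAMPLE, WITH
EXPONENTIAL CONFIDENCE.** There is ONE measurable monotone read-out `g : ℝ → [0, 9/50]` such that the local estimator
`T_B(U) = g(#B⁻¹ Σ_{x∈B} W(θ_x U))` satisfies, for every `b ∈ [0, 1/9)`, every DLR state `μ ∈ 𝒢(b)`, every finite nonempty `B ⊂ ℤ⁴` and every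
`ε ≥ 0`: `μ{ε ≤ |T_B − b|} ≤ 2e^{2/3} exp(−(e^{−216/25}/24) ε √((1 − 9b)#B/64))`. [folklore] -/
theorem su2_coupling_estimator_exp :
    ∃ g : ℝ → ℝ, Measurable g ∧ Monotone g ∧ (∀ y, g y ∈ Icc (0 : ℝ) (9 / 50)) ∧
      ∀ b : ℝ, 0 ≤ b → b < 1 / 9 → ∀ μ : Measure (LGConfig 4 (SUN 2)), μ ∈ ymGibbsMeasures (d := 4) (fundamentalRep (Fin 2)) b →
        ∀ B : Finset (Literature.Probability.LatticeModels.Site 4), B.Nonempty → ∀ ε : ℝ, 0 ≤ ε →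
          μ.real {U | ε ≤ |g ((∑ x ∈ B, zdPlaquetteObs (fundamentalRep (Fin 2)) 0 0 1 (configShift x U)) / B.card) - b|} ≤
            2 * (Real.exp (2 / 3) * Real.exp (-(Real.exp (-(216 / 25)) / 24 * ε * Real.sqrt ((1 - 9 * b) * B.card / 64)))) := by
  obtain ⟨g, hmono, hrange, hg⟩ := su2_coupling_readout
  exact ⟨g, hmono.measurable, hmono, hrange, fun b hb0 hb μ hμ B hB ε hε => su2_couplingEstimator_tail_exp hg hb0 hb hμ hB hε⟩

end SU2

end CouplingEstimation

end Summit.Ventures.YMGap.RobustBall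

end
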